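import Mathlib
import Summits.CriticalPhenomena.PercolationContinuityZ3.Theorems.PercNearOneGluingNearOneGluingKnLemma3i
import Summits.CriticalPhenomena.PercolationContinuityZ3.Theorems.PercNearOneGluingNearOneGluingPivotalityDomination
import Literature.Probability.Percolation.PercolationProofs
import HarnessLib

/-!
# Crux `PercNearOneGluing.NearOneGluing` (stmt-CriticalPhenomena-4574), line `SketchR2I5` — stub `stub_tieLemma`

Helper file for the crux (lead prover-line-stmt-CriticalPhenomena-4574-c5, cycle 5): the **tie lemma** of
the `|A| = 3` kernel of RESCUE.  Proves exactly the registered stub signature; lands with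
`--supports stmt-CriticalPhenomena-4574`.

## Content

Finite weighted graph on `Fin n` (`μ = prodBernoulli w` on bond configurations), target `b`, three
relays `x, y, z` with `x` at least as reliable as `y`: `μ(y ↔ b) ≤ μ(x ↔ b)`.  THEOREM (`stub_tieLemma`):

  `μ(z ↮ b, y ↔ b, x ↔ z) ≤ μ(y ↮ b, z ↔ b, x ↮ y)`

— "the least relay dead while TIED to the most reliable one, the middle one alive" is rarer than
"the middle one dead and NOT tied to the most reliable one, the least one alive"; the reliability of `z`
plays no role.  In the notation of the lead notes (Cruxes/NearOneGluing/NOTES.md §F.8–F.9) this is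
`μ(f₁ ∩ {x ↔ z}) ≤ μ(f₂ ∩ {x ↮ y})`; it gives `μ(f_x) ≤ μ(f₂)` for the glued-rescue event
`f_x = (f₂ ∩ {x ↔ y}) ⊔ (f₁ ∩ {x ↔ z})`, and it is exactly the inequality (★) to which the x-term bound
(N1) reduces at depth one with `z` unattached — the first proved instance of (N1).

Proof.  Put `D = {x ↮ y}`.  (i) On the left event `x ↔ z ↮ b` forces `x ↮ b`, and `x` dead with `y`
alive forces `x ↮ y`; so the left side is at most `μ(D ∩ {y ↔ b} ∩ {x ↔ z})`.  (ii) van den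
Berg–Häggström–Kahn 2006 Thm. 1.4 for the sources `y`, `x` given `D` (`knLemma3i_twoCluster`, `{x ↔ z}` is
increasing in the open edge cluster of `x`): `μ(D) μ(D ∩ {y↔b} ∩ {x↔z}) ≤ μ(D ∩ {y↔b}) μ(D ∩ {x↔z})`.
(iii) Off `D` the events `{y ↔ b}` and `{x ↔ b}` coincide, so `μ(D ∩ {y↔b}) − μ(D ∩ {x↔b}) =
μ(y↔b) − μ(x↔b) ≤ 0`.  (iv) BHK Thm. 1.3 for the source `x` given `D` (`knLemma3i_oneCluster`):
`μ(D ∩ {x↔b}) μ(D ∩ {x↔z}) ≤ μ(D) μ(D ∩ {x↔b} ∩ {x↔z})`.  (v) `x ↔ b` with `x ↔ z` gives `z ↔ b`, and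
`x ↔ b` with `x ↮ y` gives `y ↮ b` (else `x ↔ b ↔ y`); so `D ∩ {x↔b} ∩ {x↔z} ⊆ {y ↮ b} ∩ {z ↔ b} ∩ D`.
Chaining and cancelling `μ(D) > 0` (if `μ(D) = 0` the left side, a subset of `D`, is null) gives the claim.
-/

namespace Summit.CriticalPhenomena.PercolationContinuityZ3.Theorems

open MeasureTheory Set Literature.Probability.LatticeModels Literature.Probability.Percolation
open scoped Classical BigOperators

/-- **Tie lemma.**  For `μ(y ↔ b) ≤ μ(x ↔ b)` and any `z`:
`μ({z ↮ b} ∩ {y ↔ b} ∩ {x ↔ z}) ≤ μ({y ↮ b} ∩ {z ↔ b} ∩ {x ↮ y})`.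
From van den Berg–Häggström–Kahn (2006) Thms. 1.3 and 1.4 for the pair of sources `(x, y)` given
`{x ↮ y}` (`knLemma3i_oneCluster`, `knLemma3i_twoCluster`) and the cancellation of the common part
`{x ↔ y ↔ b}` in the hypothesis. -/
theorem stub_tieLemma :
    ∀ (n : ℕ) (w : Sym2 (Fin n) → unitInterval) (b x y z : Fin n),
      (prodBernoulli w).real (openConn y b) ≤ (prodBernoulli w).real (openConn x b) →
      (prodBernoulli w).real ((openConn z b)ᶜ ∩ openConn y b ∩ openConn x z) ≤
        (prodBernoulli w).real ((openConn y b)ᶜ ∩ openConn z b ∩ (openConn x y)ᶜ) := by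
  intro n w b x y z hle
  have hm : ∀ E : Set (BondConfig (Fin n)), MeasurableSet E := fun _ => MeasurableSet.of_discrete
  set μ := prodBernoulli w with hμ
  set D : Set (BondConfig (Fin n)) := (openConn x y)ᶜ with hD
  -- (i) the left event lies in `D ∩ {y ↔ b} ∩ {x ↔ z}`
  have hL : ((openConn z b)ᶜ ∩ openConn y b ∩ openConn x z : Set (BondConfig (Fin n))) ⊆
      D ∩ (openConn y b ∩ openConn x z) := by
    rintro ω ⟨⟨hzb, hyb⟩, hxz⟩
    refine ⟨fun hxy => hzb ?_, hyb, hxz⟩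
    -- `z ↔ x ↔ y ↔ b`
    exact (SimpleGraph.Reachable.symm hxz).trans (SimpleGraph.Reachable.trans hxy hyb)
  -- (v) the right event contains `D ∩ {x ↔ b} ∩ {x ↔ z}`
  have hR : (D ∩ (openConn x b ∩ openConn x z) : Set (BondConfig (Fin n))) ⊆
      (openConn y b)ᶜ ∩ openConn z b ∩ (openConn x y)ᶜ := by
    rintro ω ⟨hxy, hxb, hxz⟩
    refine ⟨⟨fun hyb => hxy ?_, (SimpleGraph.Reachable.symm hxz).trans hxb⟩, hxy⟩
    -- `x ↔ b ↔ y`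
    exact SimpleGraph.Reachable.trans hxb (SimpleGraph.Reachable.symm hyb)
  -- degenerate case `x = y`: then `D = ∅`
  rcases eq_or_ne x y with hxy | hxy
  · have hDe : D = ∅ := by
      rw [hD, Set.compl_empty_iff, hxy]
      exact Set.eq_univ_of_forall fun ω => SimpleGraph.Reachable.refl _
    calc μ.real ((openConn z b)ᶜ ∩ openConn y b ∩ openConn x z)
        ≤ μ.real (D ∩ (openConn y b ∩ openConn x z)) := measureReal_mono hL (measure_ne_top _ _)
      _ = 0 := by rw [hDe, Set.empty_inter, measureReal_empty]
      _ ≤ μ.real ((openConn y b)ᶜ ∩ openConn z b ∩ (openConn x y)ᶜ) := measureReal_nonneg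
  -- (ii) BHK Thm. 1.4 for the sources `y`, `x`: `D' = (openConn y x)ᶜ = D`
  have hDsymm : ((openConn y x)ᶜ : Set (BondConfig (Fin n))) = D := by
    rw [hD]
    ext ω
    exact not_congr ⟨fun h => SimpleGraph.Reachable.symm h, fun h => SimpleGraph.Reachable.symm h⟩
  have h2 := knLemma3i_twoCluster w y x b (openConn x z) (pivDom_openConn_mono_openEdgeCluster x z)
    (Ne.symm hxy)
  rw [hDsymm] at h2
  -- `h2 : μ D * μ (D ∩ ({y↔b} ∩ {x↔z})) ≤ μ (D ∩ {y↔b}) * μ (D ∩ {x↔z})`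
  -- (iv) BHK Thm. 1.3 for the source `x` given `{x ↮ y}`
  have h4 := knLemma3i_oneCluster w x y b (openConn x z) (pivDom_openConn_mono_openEdgeCluster x z)
    hxy
  -- `h4 : μ (D ∩ {x↔b}) * μ (D ∩ {x↔z}) ≤ μ D * μ (D ∩ ({x↔b} ∩ {x↔z}))`
  -- (iii) `μ(D ∩ {y↔b}) ≤ μ(D ∩ {x↔b})`: off `D` the two connection events coincide
  have hsplit : ∀ E : Set (BondConfig (Fin n)), μ.real E = μ.real (E ∩ D) + μ.real (E ∩ Dᶜ) := by
    intro E
    have h := measureReal_inter_add_sdiff (μ := μ) (s := E) (t := D) (hm D)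
    rw [Set.sdiff_eq_compl_inter, Set.inter_comm Dᶜ E] at h
    exact h.symm
  have hoff : (openConn y b ∩ Dᶜ : Set (BondConfig (Fin n))) = openConn x b ∩ Dᶜ := by
    ext ω
    simp only [hD, compl_compl, Set.mem_inter_iff]
    constructor
    · rintro ⟨hyb, hxy'⟩
      exact ⟨SimpleGraph.Reachable.trans hxy' hyb, hxy'⟩
    · rintro ⟨hxb, hxy'⟩
      exact ⟨(SimpleGraph.Reachable.symm hxy').trans hxb, hxy'⟩
  have h3 : μ.real (D ∩ openConn y b) ≤ μ.real (D ∩ openConn x b) := by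
    have hy := hsplit (openConn y b)
    have hx := hsplit (openConn x b)
    rw [hoff] at hy
    rw [Set.inter_comm D (openConn y b), Set.inter_comm D (openConn x b)]
    linarith
  -- chain the four inequalities
  have hA : μ.real ((openConn z b)ᶜ ∩ openConn y b ∩ openConn x z) ≤
      μ.real (D ∩ (openConn y b ∩ openConn x z)) := measureReal_mono hL (measure_ne_top _ _)
  have hE : μ.real (D ∩ (openConn x b ∩ openConn x z)) ≤
      μ.real ((openConn y b)ᶜ ∩ openConn z b ∩ (openConn x y)ᶜ) :=
    measureReal_mono hR (measure_ne_top _ _)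
  rcases (measureReal_nonneg (μ := μ) (s := D)).eq_or_lt with hD0 | hDpos
  · -- `μ(D) = 0`: the left side is a subset of `D`
    calc μ.real ((openConn z b)ᶜ ∩ openConn y b ∩ openConn x z)
        ≤ μ.real (D ∩ (openConn y b ∩ openConn x z)) := hA
      _ ≤ μ.real D := measureReal_mono Set.inter_subset_left (measure_ne_top _ _)
      _ = 0 := hD0.symm
      _ ≤ μ.real ((openConn y b)ᶜ ∩ openConn z b ∩ (openConn x y)ᶜ) := measureReal_nonneg
  · -- `μ(D) > 0`: `μ(D) μ(L) ≤ μ(D ∩ yb) μ(D ∩ xz) ≤ μ(D ∩ xb) μ(D ∩ xz) ≤ μ(D) μ(D ∩ xb ∩ xz) ≤ μ(D) μ(R)`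
    have hxz0 : 0 ≤ μ.real (D ∩ openConn x z) := measureReal_nonneg
    have key : μ.real D * μ.real (D ∩ (openConn y b ∩ openConn x z)) ≤
        μ.real D * μ.real (D ∩ (openConn x b ∩ openConn x z)) :=
      calc μ.real D * μ.real (D ∩ (openConn y b ∩ openConn x z))
          ≤ μ.real (D ∩ openConn y b) * μ.real (D ∩ openConn x z) := h2
        _ ≤ μ.real (D ∩ openConn x b) * μ.real (D ∩ openConn x z) :=
            mul_le_mul_of_nonneg_right h3 hxz0
        _ ≤ μ.real D * μ.real (D ∩ (openConn x b ∩ openConn x z)) := h4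
    have key' := le_of_mul_le_mul_left key hDpos
    exact hA.trans (key'.trans hE)

end Summit.CriticalPhenomena.PercolationContinuityZ3.Theorems
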